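import Mathlib.Data.Fintype.Perm
import Mathlib.Data.Fintype.BigOperators
import Mathlib.Tactic.Abel
import Literature.Computability.AlgebraicComplexity.GroupTheoreticMatMul
import Literature.Computability.AlgebraicComplexity.CohnUmansTPPProofs
import Literature.RepresentationTheory.FiniteGroups.AbelianSubgroupDegreeBound
import HarnessLib

/-!
# CKSU 2005, Thm. 7.1: STPP triples give the ordinary TPP in the wreath product `Sym_n ⋉ Hⁿ`

Topic `Literature/Computability/AlgebraicComplexity`. Source: H. Cohn, R. Kleinberg, B. Szegedy,
C. Umans, *Group-theoretic algorithms for matrix multiplication*, FOCS 2005, §7 "The wreath product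
construction" (arXiv:math/0511460, held text `paper:arxiv-math_0511460`, chunks p0011 L77 – p0012 L35;
FOCS numbering Thm. 7.1 / Lemma 7.2 = arXiv Thm. 38 / Lemma 39; Lemma 1.? on wreath character degrees
= arXiv Lemma 2), read this session.

"Let `H` be a group, and define `G = Sym_n ⋉ Hⁿ`, where the symmetric group `Sym_n` acts on `Hⁿ` from
the right by permuting the coordinates according to `(h^π)ᵢ = h_{π(i)}`. We write elements of `G` as
`hπ` with `h ∈ Hⁿ` and `π ∈ Sym_n`. **Theorem 7.1.** If `n` triples of subsets `Aᵢ, Bᵢ, Cᵢ ⊆ H`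
satisfy the simultaneous triple product property, then the following subsets `H₁, H₂, H₃` of
`G = Sym_n ⋉ Hⁿ` satisfy the triple product property: `H₁ = {hπ : π ∈ Sym_n, hᵢ ∈ Aᵢ for each i}`,
`H₂ = {hπ : … hᵢ ∈ Bᵢ …}`, `H₃ = {hπ : … hᵢ ∈ Cᵢ …}`." Proof as printed: the `Sym_n`-components
force `π₁π₁'⁻¹ π₂π₂'⁻¹ π₃π₃'⁻¹ = 1`; with `π = π₁π₁'⁻¹`, `ρ = π₁π₁'⁻¹π₂π₂'⁻¹` the `Hⁿ`-component reads,
coordinate by coordinate, `(h₃'⁻¹)ᵢ (h₁)ᵢ (h₁'⁻¹)_{π(i)} (h₂)_{π(i)} (h₂'⁻¹)_{ρ(i)} (h₃)_{ρ(i)} = 1`, so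
"by the simultaneous triple product property, we find that `π(i) = ρ(i) = i`. Thus, `π = ρ = 1` …
Finally … `h₁ = h₁'`, `h₂ = h₂'`, and `h₃ = h₃'`". This shows "that the ordinary triple product property
… is as strong as the simultaneous triple product property" (p0011 L80–84).

"**Lemma 7.2.** If `H` is a finite group with character degrees `{d_k}` and `n` triples of subsets
`Aᵢ, Bᵢ, Cᵢ ⊆ H` satisfy the simultaneous triple product property, then
`(∏ᵢ |Aᵢ||Bᵢ||Cᵢ|)^{ω/3} ≤ (n!)^{−1} (Σ_k d_k^ω)ⁿ`. *Proof.* The sizes of the three subsets of `G` in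
Theorem 7.1 are `n! ∏|Aᵢ|`, `n! ∏|Bᵢ|`, and `n! ∏|Cᵢ|` … Applying Theorem 1.8 … By Lemma [2] the
right-hand-side is at most `(n!)^{ω−1} (Σ_k d_k^ω)ⁿ` …", where Lemma 2 (abelian case, as printed):
"the character degrees of `Sym_n ⋉ Hⁿ` are at most `n!` (which is the index of `Hⁿ` in `Sym_n ⋉ Hⁿ`)".

## Formalisation (abelian `H`, additive — the setting of the tree's `IsSTPP`, `GroupTheoreticMatMul.lean`)

* `SymWreath H n` — the group `Sym_n ⋉ Hⁿ` written out exactly like Mathlib's `RegularWreathProduct`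
  (pairs `⟨h, π⟩`, `hπ · h'π' = (h + h'^{π⁻¹}) ππ'` with `(h^σ)ᵢ = h_{σ i}`), for an additive abelian
  group `H`; `card_symWreath`: `|G| = |H|ⁿ · n!`.
* `stppSet A` — `{hπ : hᵢ ∈ Aᵢ for each i}`; `card_stppSet`: `|H₁| = n! ∏ᵢ |Aᵢ|` (written
  `(∏ᵢ |Aᵢ|) · n!`).
* `CohnKleinbergSzegedyUmans2005_thm38` — **Theorem 7.1**: `IsSTPP A B C` ⇒ `H₁, H₂, H₃` satisfy the
  tree's `Q(S)`-form of the TPP, hence `realizesTPP_symWreath`: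
  `G` realizes `⟨n!∏|Aᵢ|, n!∏|Bᵢ|, n!∏|Cᵢ|⟩` (`RealizesTPP`, `CohnUmansTPP.lean`).
* `maxCharDegree_symWreath_le` — Lemma 2, abelian case: degrees `≤ n!`, from Serre's Cor. to Thm. 9
  (`AbelianSubgroupDegreeBound.lean`) applied to the base `Hⁿ = {h·1}`, abelian of index `n!`.
* `CohnKleinbergSzegedyUmans2005_lemma39` — **Lemma 7.2 for abelian `H`** (`Σ d_k^ω = |H|`):
  `n! · (∏ᵢ |Aᵢ||Bᵢ||Cᵢ|)^{ω/3} ≤ |H|ⁿ`, from the tree's PROVED Cor. 1.9 (`CKSU2005_cor19_holds`).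
  (The arithmetic-mean strengthening, Thm. 5.5, is the tree's `CohnKleinbergSzegedyUmans2005_5_5_abelian_holds`,
  proved there by the tensor route; this file is the printed GROUP route up to Lemma 7.2.)

Theorems and the one structure; 0 named facts. The general (non-abelian `H`) statements need the
multiplicative form of Def. 5.1 and Lemma 2 for non-abelian `H` (Clifford theory), not attempted.
-/

noncomputable section

namespace Literature.Computability.AlgebraicComplexity

open Finset Literature.RepresentationTheory.FiniteGroups

/-- **`G = Sym_n ⋉ Hⁿ`** for an additive abelian group `H`: pairs `hπ = ⟨h, π⟩`, `h : Fin n → H`,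
`π ∈ Sym_n`, with `Sym_n` acting on `Hⁿ` by `(h^σ)ᵢ = h_{σ(i)}`, so that
`hπ · h'π' = (h + h'^{π⁻¹}) ππ'` ("We write elements of `G` as `hπ`"). Written out like Mathlib's
`RegularWreathProduct`. [cite: CohnKleinbergSzegedyUmans2005, §7 (before Thm. 7.1 = arXiv Thm. 38)] -/
@[ext]
structure SymWreath (H : Type*) (n : ℕ) where
  /-- the `Hⁿ`-component `h` of `hπ` -/
  left : Fin n → H
  /-- the `Sym_n`-component `π` of `hπ` -/
  right : Equiv.Perm (Fin n)

namespace SymWreath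

variable {H : Type*} [AddCommGroup H] {n : ℕ}

/-- `hπ · h'π' = (h + h'^{π⁻¹}) ππ'`, `(h'^{π⁻¹})ᵢ = h'_{π⁻¹ i}`. [folklore] -/
instance : Mul (SymWreath H n) where
  mul a b := ⟨fun i => a.left i + b.left (a.right⁻¹ i), a.right * b.right⟩

/-- The identity `0·1`. [folklore] -/
instance : One (SymWreath H n) where one := ⟨0, 1⟩

/-- `(hπ)⁻¹ = (−h^{π}) π⁻¹`. [folklore] -/
instance : Inv (SymWreath H n) where
  inv a := ⟨fun i => -a.left (a.right i), a.right⁻¹⟩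

/-- Component formula of the group law `hπ · h'π' = (h + h'^{π⁻¹}) ππ'`, `(h^σ)ᵢ = h_{σ(i)}`.
[cite: CohnKleinbergSzegedyUmans2005, §7 (before Thm. 7.1 = arXiv Thm. 38)] -/
@[simp] theorem mul_left (a b : SymWreath H n) :
    (a * b).left = fun i => a.left i + b.left (a.right⁻¹ i) := rfl

/-- Component formula of the group law `hπ · h'π' = (h + h'^{π⁻¹}) ππ'`, `(h^σ)ᵢ = h_{σ(i)}`.
[cite: CohnKleinbergSzegedyUmans2005, §7 (before Thm. 7.1 = arXiv Thm. 38)] -/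
@[simp] theorem mul_right (a b : SymWreath H n) : (a * b).right = a.right * b.right := rfl

/-- Component formula of the group law `hπ · h'π' = (h + h'^{π⁻¹}) ππ'`, `(h^σ)ᵢ = h_{σ(i)}`.
[cite: CohnKleinbergSzegedyUmans2005, §7 (before Thm. 7.1 = arXiv Thm. 38)] -/
@[simp] theorem one_left : (1 : SymWreath H n).left = 0 := rfl

/-- Component formula of the group law `hπ · h'π' = (h + h'^{π⁻¹}) ππ'`, `(h^σ)ᵢ = h_{σ(i)}`.
[cite: CohnKleinbergSzegedyUmans2005, §7 (before Thm. 7.1 = arXiv Thm. 38)] -/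
@[simp] theorem one_right : (1 : SymWreath H n).right = 1 := rfl

/-- Component formula of the group law `hπ · h'π' = (h + h'^{π⁻¹}) ππ'`, `(h^σ)ᵢ = h_{σ(i)}`.
[cite: CohnKleinbergSzegedyUmans2005, §7 (before Thm. 7.1 = arXiv Thm. 38)] -/
@[simp] theorem inv_left (a : SymWreath H n) : a⁻¹.left = fun i => -a.left (a.right i) := rfl

/-- Component formula of the group law `hπ · h'π' = (h + h'^{π⁻¹}) ππ'`, `(h^σ)ᵢ = h_{σ(i)}`.
[cite: CohnKleinbergSzegedyUmans2005, §7 (before Thm. 7.1 = arXiv Thm. 38)] -/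
@[simp] theorem inv_right (a : SymWreath H n) : a⁻¹.right = a.right⁻¹ := rfl

/-- `Sym_n ⋉ Hⁿ` is a group. [folklore] -/
instance : Group (SymWreath H n) where
  mul_assoc a b c := by
    ext i
    · simp [add_assoc]
    · simp [mul_assoc]
  one_mul a := by ext i <;> simp
  mul_one a := by ext i <;> simp
  inv_mul_cancel a := by ext i <;> simp

/-- `G ≃ Hⁿ × Sym_n` as sets. [folklore] -/
def equivProd : SymWreath H n ≃ (Fin n → H) × Equiv.Perm (Fin n) where
  toFun w := ⟨w.left, w.right⟩
  invFun p := ⟨p.1, p.2⟩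
  left_inv _ := rfl
  right_inv _ := rfl

/-- Finiteness. [folklore] -/
instance [Fintype H] [DecidableEq H] : Fintype (SymWreath H n) := Fintype.ofEquiv _ equivProd.symm

/-- Decidable equality. [folklore] -/
instance [DecidableEq H] : DecidableEq (SymWreath H n) := equivProd.decidableEq

omit [AddCommGroup H] in
/-- `|Sym_n ⋉ Hⁿ| = |H|ⁿ · n!`. [cite: CohnKleinbergSzegedyUmans2005, §7 (proof of Lemma 7.2 = arXiv Lemma 39)] -/
theorem card_symWreath [Fintype H] [DecidableEq H] :
    Nat.card (SymWreath H n) = Fintype.card H ^ n * n.factorial := by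
  rw [Nat.card_eq_fintype_card, Fintype.card_congr (equivProd (H := H) (n := n)),
    Fintype.card_prod, Fintype.card_fun, Fintype.card_fin, Fintype.card_perm, Fintype.card_fin]

/-! ### The three subsets `Hᵢ = {hπ : hᵢ ∈ Aᵢ}` -/

/-- `{hπ : π ∈ Sym_n, hᵢ ∈ Aᵢ for each i}`. [cite: CohnKleinbergSzegedyUmans2005, Thm. 7.1 (arXiv Thm. 38)] -/
def stppSet [DecidableEq H] (A : Fin n → Finset H) : Finset (SymWreath H n) :=
  (Fintype.piFinset A ×ˢ (Finset.univ : Finset (Equiv.Perm (Fin n)))).image fun p => ⟨p.1, p.2⟩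

omit [AddCommGroup H] in
/-- Membership: `hπ ∈ H_A ↔ ∀ i, hᵢ ∈ Aᵢ`. [cite: CohnKleinbergSzegedyUmans2005, Thm. 7.1 (arXiv Thm. 38)] -/
theorem mem_stppSet [DecidableEq H] {A : Fin n → Finset H} {w : SymWreath H n} :
    w ∈ stppSet A ↔ ∀ i, w.left i ∈ A i := by
  constructor
  · intro h
    obtain ⟨⟨f, π⟩, hp, rfl⟩ := Finset.mem_image.mp h
    exact Fintype.mem_piFinset.mp (Finset.mem_product.mp hp).1
  · intro h
    exact Finset.mem_image.mpr ⟨⟨w.left, w.right⟩,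
      Finset.mem_product.mpr ⟨Fintype.mem_piFinset.mpr h, Finset.mem_univ _⟩, rfl⟩

omit [AddCommGroup H] in
/-- "The sizes of the three subsets of `G` in Theorem 7.1 are `n!∏|Aᵢ|`, …": `|H_A| = (∏ᵢ |Aᵢ|) · n!`.
[cite: CohnKleinbergSzegedyUmans2005, Lemma 7.2 (arXiv Lemma 39), proof] -/
theorem card_stppSet [DecidableEq H] (A : Fin n → Finset H) :
    (stppSet A).card = (∏ i, (A i).card) * n.factorial := by
  have hinj : Function.Injective fun p : (Fin n → H) × Equiv.Perm (Fin n) =>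
      (⟨p.1, p.2⟩ : SymWreath H n) := by
    rintro ⟨f, π⟩ ⟨g, σ⟩ h
    simp only [SymWreath.mk.injEq] at h
    exact Prod.ext h.1 h.2
  rw [stppSet, Finset.card_image_of_injective _ hinj, Finset.card_product, Fintype.card_piFinset,
    Finset.card_univ, Fintype.card_perm, Fintype.card_fin]

/-! ### Theorem 7.1 / 38 -/

/-- The `Hⁿ`-component of a right quotient: `(s s'⁻¹)ᵢ = sᵢ − s'_{P⁻¹ i}` with `P = π_s π_{s'}⁻¹`.
[folklore] -/
private theorem mul_inv_left_apply (s s' : SymWreath H n) (j : Fin n) :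
    (s * s'⁻¹).left j = s.left j - s'.left ((s * s'⁻¹).right⁻¹ j) := by
  simp [sub_eq_add_neg, mul_inv_rev]

/-- The `Hⁿ`-component of a triple product: `(XYZ)ᵢ = Xᵢ + Y_{P⁻¹ i} + Z_{Q⁻¹ P⁻¹ i}`. [folklore] -/
private theorem mul_mul_left_apply (X Y Z : SymWreath H n) (i : Fin n) :
    (X * Y * Z).left i = X.left i + Y.left (X.right⁻¹ i) + Z.left (Y.right⁻¹ (X.right⁻¹ i)) := by
  simp [mul_inv_rev]

/-- **Cohn–Kleinberg–Szegedy–Umans 2005, Theorem 7.1 (arXiv Thm. 38)**, abelian `H`: if the triples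
`(Aᵢ, Bᵢ, Cᵢ)_{i<n}` satisfy the simultaneous triple product property (the tree's `IsSTPP`), then
`H₁ = {hπ : hᵢ ∈ Aᵢ}`, `H₂ = {hπ : hᵢ ∈ Bᵢ}`, `H₃ = {hπ : hᵢ ∈ Cᵢ}` satisfy the triple product property
in `G = Sym_n ⋉ Hⁿ` (in the `Q(S)`-form of `RealizesTPP`). Proof as printed: with `P = π₁π₁'⁻¹`,
`Q = π₂π₂'⁻¹`, `R = π₃π₃'⁻¹` the `Sym_n`-component gives `PQR = 1`, coordinate `i` of the
`Hⁿ`-component is an STPP relation among the indices `i, P⁻¹i, (PQ)⁻¹i`, so these coincide, `P = Q = 1`,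
and then `h₁ = h₁'`, `h₂ = h₂'`, `h₃ = h₃'`. [cite: CohnKleinbergSzegedyUmans2005, Thm. 7.1 (arXiv Thm. 38)] -/
theorem CohnKleinbergSzegedyUmans2005_thm38 [DecidableEq H] {A B C : Fin n → Finset H}
    (hS : IsSTPP A B C) :
    ∀ s ∈ stppSet A, ∀ s' ∈ stppSet A, ∀ t ∈ stppSet B, ∀ t' ∈ stppSet B,
      ∀ u ∈ stppSet C, ∀ u' ∈ stppSet C,
      s * s'⁻¹ * (t * t'⁻¹) * (u * u'⁻¹) = 1 → s = s' ∧ t = t' ∧ u = u' := by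
  intro s hs s' hs' t ht t' ht' u hu u' hu' h
  rw [mem_stppSet] at hs hs' ht ht' hu hu'
  -- the `Sym_n`-component: `P Q R = 1`
  have hPQR : (s * s'⁻¹).right * (t * t'⁻¹).right * (u * u'⁻¹).right = 1 :=
    congrArg SymWreath.right h
  set P := (s * s'⁻¹).right with hP
  set Q := (t * t'⁻¹).right with hQ
  set R := (u * u'⁻¹).right with hR
  have hRQP : ∀ i, R⁻¹ (Q⁻¹ (P⁻¹ i)) = i := fun i => by
    have e : (P * Q * R)⁻¹ = 1 := by rw [hPQR, inv_one]
    have := congrArg (fun g : Equiv.Perm (Fin n) => g i) e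
    simpa [mul_inv_rev] using this
  -- the `Hⁿ`-component, coordinate by coordinate
  have hcoord : ∀ i, P⁻¹ i = i ∧ Q⁻¹ (P⁻¹ i) = i ∧ s.left i = s'.left i ∧
      t.left i = t'.left i ∧ u.left i = u'.left i := by
    intro i
    have hL : (s * s'⁻¹ * (t * t'⁻¹) * (u * u'⁻¹)).left i = 0 := by rw [h]; rfl
    rw [mul_mul_left_apply, mul_inv_left_apply s s', mul_inv_left_apply t t',
      mul_inv_left_apply u u'] at hL
    rw [← hP, ← hQ, ← hR, hRQP i] at hL
    -- `hL : (sᵢ − s'_b) + ((t_b − t'_c) + (u_c − u'ᵢ)) = 0`, `b = P⁻¹ i`, `c = Q⁻¹ P⁻¹ i`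
    obtain ⟨h1, h2, h3, h4, h5⟩ := hS (P⁻¹ i) (Q⁻¹ (P⁻¹ i)) i (s.left i) (hs i)
      (s'.left (P⁻¹ i)) (hs' _) (t.left (P⁻¹ i)) (ht _) (t'.left (Q⁻¹ (P⁻¹ i))) (ht' _)
      (u.left (Q⁻¹ (P⁻¹ i))) (hu _) (u'.left i) (hu' i) (by rw [← neg_eq_zero, ← hL]; abel)
    have hb : P⁻¹ i = i := h1.trans h2
    rw [h2] at h4 h5
    rw [hb] at h3 h4
    exact ⟨hb, h2, h3, h4, h5⟩
  -- `P = Q = R = 1`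
  have hP1 : P = 1 := inv_eq_one.mp (Equiv.ext fun i => by simpa using (hcoord i).1)
  have hQ1 : Q = 1 := inv_eq_one.mp (Equiv.ext fun i => by
    have h2 := (hcoord i).2.1
    rw [(hcoord i).1] at h2
    simpa using h2)
  have hR1 : R = 1 := by rwa [hP1, hQ1, one_mul, one_mul] at hPQR
  have e1 : s.right * s'.right⁻¹ = 1 := by rw [hP] at hP1; exact hP1
  have e2 : t.right * t'.right⁻¹ = 1 := by rw [hQ] at hQ1; exact hQ1
  have e3 : u.right * u'.right⁻¹ = 1 := by rw [hR] at hR1; exact hR1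
  exact ⟨SymWreath.ext (funext fun i => (hcoord i).2.2.1) (mul_inv_eq_one.mp e1),
    SymWreath.ext (funext fun i => (hcoord i).2.2.2.1) (mul_inv_eq_one.mp e2),
    SymWreath.ext (funext fun i => (hcoord i).2.2.2.2) (mul_inv_eq_one.mp e3)⟩

/-- **`Sym_n ⋉ Hⁿ` realizes `⟨n!∏|Aᵢ|, n!∏|Bᵢ|, n!∏|Cᵢ|⟩`** for every STPP family `(Aᵢ, Bᵢ, Cᵢ)` in an
abelian group `H` (Theorem 7.1 with the sizes from the proof of Lemma 7.2), in the tree's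
`RealizesTPP`. [cite: CohnKleinbergSzegedyUmans2005, Thm. 7.1 (arXiv Thm. 38)] -/
theorem realizesTPP_symWreath [DecidableEq H] {A B C : Fin n → Finset H} (hS : IsSTPP A B C) :
    RealizesTPP (SymWreath H n) ((∏ i, (A i).card) * n.factorial)
      ((∏ i, (B i).card) * n.factorial) ((∏ i, (C i).card) * n.factorial) :=
  ⟨stppSet A, stppSet B, stppSet C, card_stppSet A, card_stppSet B, card_stppSet C,
    CohnKleinbergSzegedyUmans2005_thm38 hS⟩

/-! ### Lemma 2 (abelian case): the character degrees of `Sym_n ⋉ Hⁿ` are at most `n!` -/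

/-- The projection `hπ ↦ π`. [folklore] -/
def rightHom : SymWreath H n →* Equiv.Perm (Fin n) where
  toFun := SymWreath.right
  map_one' := rfl
  map_mul' _ _ := rfl

/-- The base `Hⁿ = {h·1}` of the wreath product: the kernel of `hπ ↦ π`.
[cite: CohnKleinbergSzegedyUmans2005, Lemma 2 (arXiv numbering; "the index of `Hⁿ` in `Sym_n ⋉ Hⁿ`")] -/
def base : Subgroup (SymWreath H n) := (rightHom : SymWreath H n →* Equiv.Perm (Fin n)).ker

/-- Membership in the base. [folklore] -/
private theorem mem_base {w : SymWreath H n} : w ∈ base (H := H) (n := n) ↔ w.right = 1 :=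
  MonoidHom.mem_ker

/-- The base `Hⁿ` is abelian. [folklore] -/
instance : IsMulCommutative (base (H := H) (n := n)) :=
  ⟨⟨fun a b => by
    apply Subtype.ext
    have ha : a.1.right = 1 := mem_base.mp a.2
    have hb : b.1.right = 1 := mem_base.mp b.2
    apply SymWreath.ext
    · funext i
      simp only [Subgroup.coe_mul, mul_left, ha, hb, inv_one, Equiv.Perm.one_apply]
      exact add_comm _ _
    · simp only [Subgroup.coe_mul, mul_right, ha, hb]⟩⟩

/-- "`n!` … is the index of `Hⁿ` in `Sym_n ⋉ Hⁿ`". [cite: CohnKleinbergSzegedyUmans2005, Lemma 2 (arXiv numbering), proof sketch] -/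
theorem index_base : (base (H := H) (n := n)).index = n.factorial := by
  have hsurj : Function.Surjective (rightHom : SymWreath H n →* Equiv.Perm (Fin n)) :=
    fun π => ⟨⟨0, π⟩, rfl⟩
  rw [base, Subgroup.index_ker, MonoidHom.range_eq_top.mpr hsurj, Subgroup.card_top,
    Nat.card_eq_fintype_card, Fintype.card_perm, Fintype.card_fin]

/-- The base has finite index. [folklore] -/
instance : (base (H := H) (n := n)).FiniteIndex :=
  ⟨by rw [index_base]; exact Nat.factorial_ne_zero n⟩

/-- **CKSU 2005, Lemma 2 (arXiv numbering), abelian case**: "the character degrees of `Sym_n ⋉ Hⁿ` are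
at most `n!` (which is the index of `Hⁿ` in `Sym_n ⋉ Hⁿ`)" — via Serre's Cor. to Thm. 9
(`maxCharDegree_le_index`). [cite: CohnKleinbergSzegedyUmans2005, Lemma 2 (arXiv numbering), proof sketch] -/
theorem maxCharDegree_symWreath_le {H : Type} [AddCommGroup H] {n : ℕ} :
    maxCharDegree (SymWreath H n) ≤ n.factorial :=
  (maxCharDegree_le_index (base (H := H) (n := n))).trans index_base.le

/-! ### Lemma 7.2 / 39 for abelian `H` -/

/-- **Cohn–Kleinberg–Szegedy–Umans 2005, Lemma 7.2 (arXiv Lemma 39), abelian `H`** (where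
`Σ_k d_k^ω = |H|`): for an STPP family `(Aᵢ, Bᵢ, Cᵢ)_{i<n}` in a finite abelian group `H`,
`n! · (∏ᵢ |Aᵢ||Bᵢ||Cᵢ|)^{ω/3} ≤ |H|ⁿ` — "Applying Theorem 1.8 [here Cor. 1.9, the tree's
`CKSU2005_cor19_holds`, with `d_max ≤ n!` and `|G| = n!|H|ⁿ`] … then dividing both sides by
`(n!)^ω`". The geometric-mean form; the arithmetic-mean form (Thm. 5.5) is the tree's
`CohnKleinbergSzegedyUmans2005_5_5_abelian_holds`. [cite: CohnKleinbergSzegedyUmans2005, Lemma 7.2 (arXiv Lemma 39)] -/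
theorem CohnKleinbergSzegedyUmans2005_lemma39 {H : Type} [AddCommGroup H] [Fintype H] [DecidableEq H]
    {n : ℕ} {A B C : Fin n → Finset H} (hS : IsSTPP A B C) :
    (n.factorial : ℝ) * ((∏ i, ((A i).card * (B i).card * (C i).card) : ℕ) : ℝ) ^ (omega ℂ / 3) ≤
      (Fintype.card H : ℝ) ^ n := by
  have h := CKSU2005_cor19_holds.rpow_le_of_maxCharDegree_le (realizesTPP_symWreath hS)
    (maxCharDegree_symWreath_le (H := H) (n := n))
  rw [card_symWreath] at h
  have hprod : (∏ i, (A i).card) * n.factorial * ((∏ i, (B i).card) * n.factorial) *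
      ((∏ i, (C i).card) * n.factorial) =
      n.factorial ^ 3 * ∏ i, ((A i).card * (B i).card * (C i).card) := by
    rw [Finset.prod_mul_distrib, Finset.prod_mul_distrib]; ring
  rw [hprod] at h
  have hF : (0 : ℝ) < (n.factorial : ℝ) := by exact_mod_cast Nat.factorial_pos n
  have hP : (0 : ℝ) ≤ ((∏ i, ((A i).card * (B i).card * (C i).card) : ℕ) : ℝ) := Nat.cast_nonneg _
  rw [Nat.cast_mul, Nat.cast_pow, Nat.cast_mul, Nat.cast_pow] at h
  generalize (n.factorial : ℝ) = F at h hF ⊢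
  generalize ((∏ i, ((A i).card * (B i).card * (C i).card) : ℕ) : ℝ) = P at h hP ⊢
  generalize ((Fintype.card H : ℕ) : ℝ) = M at h ⊢
  -- `h : (F³ P)^{ω/3} ≤ F^{ω-2} (Mⁿ F)`; rewrite the left side as `F^{ω-2} (F² P^{ω/3})`
  have hω : (3 : ℝ) * (omega ℂ / 3) = (omega ℂ - 2) + 2 := by ring
  have hlhs : (F ^ 3 * P) ^ (omega ℂ / 3) = F ^ (omega ℂ - 2) * (F ^ 2 * P ^ (omega ℂ / 3)) := by
    rw [Real.mul_rpow (pow_nonneg hF.le 3) hP, ← Real.rpow_natCast F 3, ← Real.rpow_mul hF.le,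
      Nat.cast_ofNat, hω, Real.rpow_add hF, Real.rpow_two, mul_assoc]
  rw [hlhs, mul_comm (M ^ n) F] at h
  have h2 : F ^ 2 * P ^ (omega ℂ / 3) ≤ F * M ^ n :=
    le_of_mul_le_mul_left h (Real.rpow_pos_of_pos hF _)
  rw [pow_two, mul_assoc] at h2
  exact le_of_mul_le_mul_left h2 hF

end SymWreath

end Literature.Computability.AlgebraicComplexity

end
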